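import Literature.NumberTheory.EllipticCurves.SemistableModPImageReducibleProofs
import Literature.NumberTheory.EllipticCurves.SerreOpenImageOfLocalInputProofs
import Literature.NumberTheory.EllipticCurves.SerreOpenImageFinalProofs
import HarnessLib

/-!
# Semistable mod-`p` images, the irreducible case: `E[p]` irreducible ⇒ `ρ̄_{E,p}` onto
# (Serre 1972, §5.4, Prop. 21 i); Edixhoven 1997, Prop. 2.1, after Oesterlé for `p = 2, 3`)

`Proofs` file (theorems only, no definitions, no named facts), topic `NumberTheory/EllipticCurves`;
fourth sibling of `SemistableModPImage.lean` on the way to the named fact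
`Literature.NumberTheory.EllipticCurves.Edixhoven1997_prop_2_1`.

Let `E = W/ℚ` be semistable, in global minimal form, `p` a prime with `E[p]` irreducible, and
`G = ρ̄_{E,p}(Γ_ℚ) ⊆ GL₂(𝔽_p)`.  Serre, §5.4, proof of Prop. 21 i): by (iii) (`det` onto) and
Prop. 15, if `p ∣ #G` then `G` is Borel (excluded: irreducible) or contains `SL₂`, hence is
everything; if `p ∤ #G`, the local structure at `p` (§1.11–1.12: `ρ̄(I_p)` is a split half-Cartan
or a non-split Cartan subgroup) and Prop. 17 with (iv) (complex conjugation) leave only case 3):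
`G ⊆ N(C)`, `G ⊄ C` for a Cartan subgroup `C`; the quadratic character `Γ_ℚ → N/C` is then
unramified at every `ℓ ≠ p` ((ii): at good `ℓ` the module `E[p]` is unramified, at multiplicative
`ℓ` the inertia acts unipotently, with order dividing `p`, hence trivially as `p ∤ #G`) and at
`p` (Prop. 14), "ce qui est absurde" (Minkowski).  For `p ≥ 7` this is literally Serre's text;
for `p = 5` with supersingular reduction the same argument applies (Prop. 17 for a non-split
Cartan needs no restriction on `p`); for `p = 2, 3` (Edixhoven, after Oesterlé): `#G ∣ 3`,
resp. `#G ∣ 16`, and an abelian quotient of `G` of order `3`, resp. `4`, would give an abelian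
extension of `ℚ` unramified outside `2`, resp. `3`, of that degree — impossible by
Kronecker–Weber (`card_range_dvd_of_forall_inertia`: the degree divides `p^e (p - 1)`).  The
remaining sub-case `p = 5`, `ρ̄(I_5)` a split half-Cartan subgroup (projective image `𝔄₄`/`𝔖₄`)
is treated in the sequel file `SemistableModPImageFiveProofs.lean`, which also assembles Prop. 21 i)
at every prime (`hasSurjectiveModNGaloisRep_of_hasIrreducibleModPGaloisRep_of_isSemistable`).

* `WeierstrassCurve.galoisRepTorsion_eq_one_of_mem_inertia_of_isSemistable` — (ii): `ρ̄_{E,p}`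
  is unramified outside `p` once `p ∤ #G`.
* `WeierstrassCurve.inertia_shape_of_isSemistable` — §1.11–1.12 at `p` in the frame-free form of
  the tree's `SerreOpenImage*` files (line with trivial quotient and full character, or cyclic
  image of order `p² - 1`).
* `WeierstrassCurve.false_of_le_normalizer_cartan_of_isSemistable` — case 3) is impossible.
* `WeierstrassCurve.hasSurjectiveModNGaloisRep_of_hasIrreducibleModPGaloisRep_of_ne_five` —
  **Prop. 21 i) for semistable `E/ℚ`, `p ≠ 5`** (and `p = 5` granted the normaliser alternative
  for a split half-Cartan inertia: `false_of_isSemistable_of_frame`).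

## References

* [Serre1972] J.-P. Serre, *Propriétés galoisiennes des points d'ordre fini des courbes
  elliptiques*, Invent. Math. 15 (1972) 259–331: §5.4 Prop. 21 and its proof; §4.2 Lemme 2;
  §2.2 Prop. 14; §2.4 Prop. 15; §2.7 Prop. 17; §1.11–1.12.
* [Edixhoven1997] B. Edixhoven, *Serre's conjecture*, in Cornell–Silverman–Stevens (1997),
  Prop. 2.1 and its proof (PDF pp. 285–286).
-/

noncomputable section

open scoped Classical NumberField
open IsDedekindDomain Field Matrix

namespace WeierstrassCurve

open Literature.NumberTheory.EllipticCurves Literature.NumberTheory.GaloisRepresentations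
  Literature.NumberTheory.GaloisRepresentations.Serre1972 NumberField Rat.HeightOneSpectrum

variable (W : WeierstrassCurve ℚ) [W.IsElliptic] (p : ℕ) [hp : Fact p.Prime]

/-! ### (ii) `ρ̄_{E,p}` is unramified outside `p` when `p ∤ #G` -/

omit [W.IsElliptic] hp in
/-- A unipotent Galois automorphism of `E[p]` (`τ (τ Q - Q) = τ Q - Q` for all `Q`) has `p`-th
power acting trivially: `τ^j Q = Q + j (τ Q - Q)`. [folklore] -/
theorem galoisRepTorsion_pow_prime_eq_one_of_unipotent {τ : absoluteGaloisGroup ℚ}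
    (h : ∀ Q : geomTorsion W p, τ • (τ • Q - Q) = τ • Q - Q) :
    galoisRepTorsion W p τ ^ p = 1 := by
  rw [← map_pow, galoisRepTorsion_eq_one_iff']
  intro Q
  set N : geomTorsion W p := τ • Q - Q with hN
  have hτQ : τ • Q = Q + N := by rw [hN]; abel
  have hτN : τ • N = N := by rw [hN]; exact h Q
  have hstep : ∀ n : ℕ, τ ^ n • Q = Q + (n : ℤ) • N := by
    intro n
    induction n with
    | zero => rw [pow_zero, one_smul, Nat.cast_zero, zero_smul, add_zero]
    | succ n ih =>
      rw [pow_succ', mul_smul, ih, smul_add, smul_comm τ (n : ℤ) N, hτN, hτQ, Nat.cast_succ,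
        add_smul, one_smul]
      abel
  have hpN : (p : ℤ) • N = 0 := Subtype.ext (by
    rw [AddSubgroupClass.coe_zsmul, ZeroMemClass.coe_zero]
    exact (mem_torsionPoints_iff _ _ (N : geomPoints W)).mp N.2)
  rw [hstep p, hpN, add_zero]

/-- **Serre 1972, §5.4, proof of Prop. 21, (ii) ⇒ Lemme 2 for semistable curves.**  For a
semistable `E/ℚ` with `p ∤ #ρ̄_{E,p}(Γ_ℚ)`, the representation `ρ̄_{E,p}` kills the inertia
group of every prime `𝔓 ∤ p` of `\bar ℤ`: at a place of good reduction `E[p]` is unramified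
(Silverman VII.4.1), at a place of multiplicative reduction the inertia acts unipotently
("l'image par `φ_p` du groupe d'inertie en `ℓ` est, soit triviale, soit cyclique d'ordre `p`",
via the Tate curve; the tree's `smul_smul_sub_eq_of_mem_inertia_geomPoints`), so through an
element of order dividing `p`, which is trivial as `p ∤ #G`.
[cite: Serre1972, §5.4 Prop. 21 (ii) and its proof] -/
theorem galoisRepTorsion_eq_one_of_mem_inertia_of_isSemistable (hsemi : W.IsSemistable (𝓞 ℚ))
    (hG : ¬ p ∣ Nat.card (galoisRepTorsion W p).range)
    {v : HeightOneSpectrum (𝓞 ℚ)} (hpv : (p : 𝓞 ℚ) ∉ v.asIdeal)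
    {𝔓 : Ideal (absIntegers (𝓞 ℚ) ℚ)} (h𝔓 : 𝔓 ∈ v.primesAbove)
    {τ : absoluteGaloisGroup ℚ} (hτ : τ ∈ 𝔓.inertia (absoluteGaloisGroup ℚ)) :
    galoisRepTorsion W p τ = 1 := by
  have hpp : p.Prime := hp.out
  rcases hsemi v with hgood | hmult
  · exact W.galoisRepTorsion_eq_one_of_mem_inertia hgood (by rwa [Int.cast_natCast]) h𝔓 hτ
  · have hunip : ∀ Q : geomTorsion W p, τ • (τ • Q - Q) = τ • Q - Q := fun Q ↦ by
      have hQ : p ^ 1 • (Q : geomPoints W) = 0 := by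
        rw [pow_one]
        have h := (mem_torsionPoints_iff _ _ (Q : geomPoints W)).mp Q.2
        rwa [natCast_zsmul] at h
      have h := W.smul_smul_sub_eq_of_mem_inertia_geomPoints hmult hpp hpv le_rfl h𝔓 hτ hQ
      exact Subtype.ext (by
        simpa only [AddSubgroup.torsionBy.coe_smul, AddSubgroupClass.coe_sub] using h)
    have hpow := galoisRepTorsion_pow_prime_eq_one_of_unipotent W p hunip
    have h1 : orderOf (galoisRepTorsion W p τ) ∣ p := orderOf_dvd_of_pow_eq_one hpow
    have h2 : orderOf (galoisRepTorsion W p τ) ∣ Nat.card (galoisRepTorsion W p).range :=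
      Subgroup.orderOf_dvd_natCard _ ⟨τ, rfl⟩
    have hcop : Nat.Coprime p (Nat.card (galoisRepTorsion W p).range) :=
      (Nat.Prime.coprime_iff_not_dvd hpp).mpr hG
    exact orderOf_eq_one_iff.mp ((Nat.Coprime.coprime_dvd_left h1 hcop).eq_one_of_dvd h2)

/-! ### §1.11–1.12: the inertia at `p` for a semistable curve -/

/-- **The image of an inertia group at `p ≠ 2` on `E[p]`, `E/ℚ` semistable in global minimal
form** (Serre 1972, §1.11 Prop. 11 with Cor. and Prop. 12 c); §1.12 Cor. of Prop. 13), in the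
frame-free form consumed by the tree's `SerreOpenImage*` files: for every prime `𝔏` of `\bar ℤ`
above `p`, *either* there is `v₀ ∈ E[p] ∖ 0` such that `I_𝔏` acts trivially on `E[p]/𝔽_p v₀`
and through all of `𝔽_pˣ` on `𝔽_p v₀` (ordinary good reduction:
`exists_line_of_not_dvd_frobeniusTrace_of_mem_primesAbove`; multiplicative reduction: the
subgroup `X` of `exists_addSubgroup_card_le_of_hasMultiplicativeReductionAt`; the character on
the line by `exists_mem_inertia_smul_eq_of_sub_mem_line`), *or* the image of `I_𝔏` is cyclic of
order `p² - 1` (supersingular good reduction: `isCyclic_and_card_inertia_map_of_dvd_frobeniusTrace`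
with the tame Kummer character `exists_mem_inertia_smul_eq_mul_of_pow_eq`).
[cite: Serre1972, §1.11 Prop. 11 Cor., Prop. 12 c); §1.12 Cor.; §5.4 Lemme 5] -/
theorem inertia_shape_of_isSemistable [W.IsGloballyMinimal] (hsemi : W.IsSemistable (𝓞 ℚ))
    (hp2 : p ≠ 2) {v : HeightOneSpectrum (𝓞 ℚ)} (hv : (primesEquiv v : ℕ) = p)
    {𝔏 : Ideal (absIntegers (𝓞 ℚ) ℚ)} (h𝔏 : 𝔏 ∈ v.primesAbove) :
    (letI : Module (ZMod p) (geomTorsion W p) := AddSubgroup.torsionBy.zmodModule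
     ∃ v₀ : geomTorsion W p, v₀ ≠ 0 ∧
       (∀ τ ∈ 𝔏.inertia (absoluteGaloisGroup ℚ), ∀ x : geomTorsion W p,
          ∃ b : ZMod p, τ • x - x = b • v₀) ∧
       (∀ a : (ZMod p)ˣ, ∃ τ ∈ 𝔏.inertia (absoluteGaloisGroup ℚ),
          τ • v₀ = (a : ZMod p) • v₀)) ∨
    (IsCyclic ((𝔏.inertia (absoluteGaloisGroup ℚ)).map (galoisRepTorsion W p)) ∧
      Nat.card ((𝔏.inertia (absoluteGaloisGroup ℚ)).map (galoisRepTorsion W p)) = p ^ 2 - 1) := by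
  letI : Module (ZMod p) (geomTorsion W p) := AddSubgroup.torsionBy.zmodModule
  have hpp : p.Prime := hp.out
  haveI : NeZero p := ⟨hpp.ne_zero⟩
  have hsurj_of : ∀ v₀ : geomTorsion W p, v₀ ≠ 0 →
      (∀ τ ∈ 𝔏.inertia (absoluteGaloisGroup ℚ), ∀ x : geomTorsion W p,
        ∃ b : ZMod p, τ • x - x = b • v₀) →
      ∀ a : (ZMod p)ˣ, ∃ τ ∈ 𝔏.inertia (absoluteGaloisGroup ℚ), τ • v₀ = (a : ZMod p) • v₀ :=
    fun v₀ hv₀ hquot a ↦ W.exists_mem_inertia_smul_eq_of_sub_mem_line p hv h𝔏 hv₀ hquot a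
  have hgen : natGenerator v = p := hv
  have hvp : (p : 𝓞 ℚ) ∈ v.asIdeal := by
    have h := (natGenerator_dvd_iff v).mp dvd_rfl
    rw [← map_natCast (Rat.IsIntegralClosure.intEquiv (𝓞 ℚ)), Ideal.apply_mem_of_equiv_iff] at h
    rwa [hgen] at h
  rcases hsemi v with hgood | hmult
  · have hgood' : W.HasGoodReductionAtPrime p :=
      (hasGoodReductionAtPrime_primesEquiv_iff_holds W v p hv).mpr hgood
    have hΔ := W.not_dvd_minimalDiscriminantInt_of_hasGoodReductionAtPrime' p hgood'
    by_cases hss : (p : ℤ) ∣ W.frobeniusTrace p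
    · -- supersingular: cyclic of order `p² - 1`, at the place's prime and then at `𝔏` by conjugation
      right
      obtain ⟨𝔓, hmem, h𝔓⟩ := exists_ideal_placeOver p hv
      obtain ⟨g, hg⟩ :=
        HeightOneSpectrum.exists_smul_eq_of_mem_primesAbove_holds (K := ℚ) (v := v) h𝔓 h𝔏
      rw [← hg]
      have hm : 0 < p ^ 2 - 1 := by
        have : 4 ≤ p ^ 2 := by nlinarith [hpp.two_le]
        omega
      exact isCyclic_and_card_map_inertia_smul (galoisRepTorsion W p) g 𝔓
        (isCyclic_and_card_inertia_map_of_dvd_frobeniusTrace p hΔ hss hp2 hmem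
          (fun π ζ hπ hζ ↦ exists_mem_inertia_smul_eq_mul_of_pow_eq p hm hv h𝔓 hπ hζ))
    · -- ordinary: the line of §1.11 (1)
      left
      obtain ⟨v₀, hv₀, hquot⟩ :=
        exists_line_of_not_dvd_frobeniusTrace_of_mem_primesAbove p hΔ hss hv h𝔏
      exact ⟨v₀, hv₀, hquot, hsurj_of v₀ hv₀ hquot⟩
  · -- multiplicative: the subgroup `X`, `#X ≤ p`, of the Tate model
    left
    obtain ⟨X, hXcard, hX⟩ :=
      W.exists_addSubgroup_card_le_of_hasMultiplicativeReductionAt hp2 hvp hmult h𝔏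
    have hcard : Nat.card (geomTorsion W p) = p ^ 2 :=
      card_torsionPoints_eq_sq_holds W (AlgebraicClosure ℚ) (n := p)
        (Nat.cast_ne_zero.mpr hpp.ne_zero)
    haveI : Finite (geomTorsion W p) :=
      Nat.finite_of_card_ne_zero (by rw [hcard]; exact pow_ne_zero _ hpp.ne_zero)
    by_cases hXbot : X = ⊥
    · haveI : Nontrivial (geomTorsion W p) := Finite.one_lt_card_iff_nontrivial.mp (by
        rw [hcard]; nlinarith [hpp.two_le])
      obtain ⟨v₀, hv₀⟩ := exists_ne (0 : geomTorsion W p)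
      have hquot : ∀ τ ∈ 𝔏.inertia (absoluteGaloisGroup ℚ), ∀ x : geomTorsion W p,
          ∃ b : ZMod p, τ • x - x = b • v₀ := fun τ hτ x ↦ ⟨0, by
        have h := hX τ hτ x
        rw [hXbot, AddSubgroup.mem_bot] at h
        rw [h, zero_smul]⟩
      exact ⟨v₀, hv₀, hquot, hsurj_of v₀ hv₀ hquot⟩
    · have hXtop : X ≠ ⊤ := by
        intro h
        rw [h, AddSubgroup.card_top, hcard] at hXcard
        nlinarith [hpp.two_le]
      obtain ⟨v₀, -, hv₀, hXeq⟩ := exists_eq_zmultiples_of_ne_bot_of_ne_top W p X hXbot hXtop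
      have hquot : ∀ τ ∈ 𝔏.inertia (absoluteGaloisGroup ℚ), ∀ x : geomTorsion W p,
          ∃ b : ZMod p, τ • x - x = b • v₀ := fun τ hτ x ↦ by
        have h := hX τ hτ x
        rw [hXeq] at h
        obtain ⟨m, hm⟩ := AddSubgroup.mem_zmultiples_iff.mp h
        exact ⟨(m : ZMod p), by rw [Int.cast_smul_eq_zsmul, hm]⟩
      exact ⟨v₀, hv₀, hquot, hsurj_of v₀ hv₀ hquot⟩

/-! ### "`ℚ` n'admet pas d'extension quadratique non ramifiée" -/

/-- An open subgroup of index `2` of `Γ_ℚ` cannot contain every inertia group (`ℚ` has no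
everywhere unramified quadratic extension — Minkowski; in the tree as the character form
`Mazur1978.monoidHom_eq_one_of_forall_inertia`). [cite: Serre1972, §5.4, proof of Prop. 21
("le corps quadratique correspondant à `G → N/C` est partout non ramifié, ce qui est absurde")] -/
theorem false_of_index_two_of_forall_inertia_le {U : Subgroup (absoluteGaloisGroup ℚ)}
    (hUo : IsOpen (U : Set (absoluteGaloisGroup ℚ))) (hUi : U.index = 2)
    (hUI : ∀ (v : HeightOneSpectrum (𝓞 ℚ)), ∀ 𝔓 ∈ v.primesAbove,
      𝔓.inertia (absoluteGaloisGroup ℚ) ≤ U) : False := by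
  haveI hUn : U.Normal := Subgroup.normal_of_index_eq_two hUi
  haveI : Fact (Nat.Prime 2) := ⟨Nat.prime_two⟩
  haveI hcyc : IsCyclic (absoluteGaloisGroup ℚ ⧸ U) := isCyclic_of_prime_card (p := 2) hUi
  letI : CommGroup (absoluteGaloisGroup ℚ ⧸ U) := IsCyclic.commGroup
  set ψ : absoluteGaloisGroup ℚ →* absoluteGaloisGroup ℚ ⧸ U := QuotientGroup.mk' U with hψ
  have hker : ψ.ker = U := QuotientGroup.ker_mk' U
  have h1 : ψ = 1 := Mazur1978.monoidHom_eq_one_of_forall_inertia ψ (by rw [hker]; exact hUo)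
    (fun v 𝔓 h𝔓 τ hτ ↦ by
      rw [← MonoidHom.mem_ker, hker]
      exact hUI v 𝔓 h𝔓 hτ)
  have htop : U = ⊤ := by
    rw [← hker, h1, MonoidHom.ker_one]
  rw [htop, Subgroup.index_top] at hUi
  exact absurd hUi (by norm_num)

/-! ### Case 3) of Prop. 21 is impossible for semistable curves -/

section Frame

variable (Φ : Multiplicative (AddAut (geomTorsion W p)) ≃* GL (Fin 2) (ZMod p))
  (e : geomTorsion W p ≃+ (Fin 2 → ZMod p))
  (he : ∀ (g : Multiplicative (AddAut (geomTorsion W p))) (x : geomTorsion W p),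
    e (Multiplicative.toAdd g x) =
      ((Φ g : GL (Fin 2) (ZMod p)) : Matrix (Fin 2) (Fin 2) (ZMod p)) *ᵥ e x)

omit [W.IsElliptic] in
/-- `#G = #ρ̄(Γ_ℚ)` for `G = Φ(ρ̄(Γ_ℚ))`. [folklore] -/
theorem card_map_range_galoisRepTorsion :
    Nat.card ((galoisRepTorsion W p).range.map Φ.toMonoidHom) =
      Nat.card (galoisRepTorsion W p).range :=
  (Nat.card_congr ((galoisRepTorsion W p).range.equivMapOfInjective Φ.toMonoidHom
    Φ.injective).toEquiv).symm

include he in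
/-- **`E[p]` irreducible and `ρ̄_{E,p}` not onto ⇒ `p ∤ #G`** (Prop. 15 with (iii): otherwise `G`
is Borel or contains `SL₂(𝔽_p)`). [cite: Serre1972, §5.4, proof of Prop. 21, first lines] -/
theorem not_dvd_card_of_not_hasSurjectiveModNGaloisRep (hirr : W.HasIrreducibleModPGaloisRep p)
    (hns : ¬ W.HasSurjectiveModNGaloisRep p) :
    ¬ p ∣ Nat.card ((galoisRepTorsion W p).range.map Φ.toMonoidHom) := by
  intro hdvd
  rcases eq_top_or_borel_of_dvd_card _ hdvd (exists_mem_map_range_det_eq W p Φ e he) with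
    h | ⟨v, hv, hB⟩
  · exact hns ((map_range_galoisRepTorsion_eq_top_iff W p Φ).mp h)
  · exact not_le_eigenvectorStabilizer_of_hasIrreducibleModPGaloisRep W p Φ e he hirr hv hB

include he in
/-- The shape of `Φ(ρ̄(I_𝔏))` for `𝔏 ∣ p`, `p ∤ #G`, `p ≠ 2`, `E` semistable minimal: a split
half-Cartan subgroup or a non-split Cartan subgroup of `GL₂(𝔽_p)`
(`inertia_shape_of_isSemistable` with `eq_halfSplitCartan_map_of_not_dvd_card`,
`exists_isField_eq_unitGroup_map_of_isCyclic`). [cite: Serre1972, §1.11–1.12; §5.4 Lemme 5] -/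
theorem inertia_map_shape_of_isSemistable [W.IsGloballyMinimal] (hsemi : W.IsSemistable (𝓞 ℚ))
    (hp2 : p ≠ 2) (hG : ¬ p ∣ Nat.card ((galoisRepTorsion W p).range.map Φ.toMonoidHom))
    {v : HeightOneSpectrum (𝓞 ℚ)} (hv : (primesEquiv v : ℕ) = p)
    {𝔏 : Ideal (absIntegers (𝓞 ℚ) ℚ)} (h𝔏 : 𝔏 ∈ v.primesAbove) :
    (∃ P : GL (Fin 2) (ZMod p),
      ((𝔏.inertia (absoluteGaloisGroup ℚ)).map (galoisRepTorsion W p)).map Φ.toMonoidHom =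
        halfSplitCartan P) ∨
    ∃ k : Subalgebra (ZMod p) (Matrix (Fin 2) (Fin 2) (ZMod p)), IsField k ∧
      Module.finrank (ZMod p) k = 2 ∧
      ((𝔏.inertia (absoluteGaloisGroup ℚ)).map (galoisRepTorsion W p)).map Φ.toMonoidHom =
        unitGroup k := by
  letI : Module (ZMod p) (geomTorsion W p) := AddSubgroup.torsionBy.zmodModule
  set ρ := galoisRepTorsion W p with hρ
  have hHle : ((𝔏.inertia (absoluteGaloisGroup ℚ)).map ρ).map Φ.toMonoidHom ≤
      ρ.range.map Φ.toMonoidHom := Subgroup.map_mono (fun x ⟨τ, _, hτ⟩ ↦ ⟨τ, hτ⟩)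
  have hpH : ¬ p ∣ Nat.card (((𝔏.inertia (absoluteGaloisGroup ℚ)).map ρ).map Φ.toMonoidHom) :=
    fun h ↦ hG (h.trans (Subgroup.card_dvd_of_le hHle))
  rcases inertia_shape_of_isSemistable W p hsemi hp2 hv h𝔏 with ⟨v₀, hv₀, hquot, hsurj⟩ | ⟨hcyc, hcard⟩
  · left
    obtain ⟨P, -, hP⟩ := eq_halfSplitCartan_map_of_not_dvd_card e Φ he
      (I := (𝔏.inertia (absoluteGaloisGroup ℚ)).map ρ) hv₀
      (fun τ' ⟨τ, hτ, hτ'⟩ x ↦ by subst hτ'; exact hquot τ hτ x)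
      (fun a ↦ by
        obtain ⟨τ, hτ, hτv⟩ := hsurj a
        exact ⟨ρ τ, ⟨τ, hτ, rfl⟩, hτv⟩) hpH
    exact ⟨P, hP⟩
  · right
    exact exists_isField_eq_unitGroup_map_of_isCyclic Φ hcyc hcard

include he in
/-- **Serre 1972, §5.4, proof of Prop. 21: case 3) is impossible** for a semistable `E/ℚ` in
global minimal form and `p ≥ 5` with `p ∤ #G`.  If `G = Φ(ρ̄_{E,p}(Γ_ℚ))` normalises a Cartan
subgroup `C` without being contained in it, the subgroup `U = ρ̄⁻¹(Φ⁻¹(C))` is open of index `2`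
and contains every inertia group: away from `p` by (ii)
(`galoisRepTorsion_eq_one_of_mem_inertia_of_isSemistable`), at `p` because the image of inertia
— a split half-Cartan or a non-split Cartan subgroup inside `N(C)` — lies in `C` (Prop. 14:
`prop14_halfSplitCartan`, `prop14_unitGroup`).  So `ℚ` would have an everywhere unramified
quadratic extension. [cite: Serre1972, §5.4, proof of Prop. 21 (end); §2.2 Prop. 14] -/
theorem false_of_le_normalizer_cartan_of_isSemistable [W.IsGloballyMinimal]
    (hsemi : W.IsSemistable (𝓞 ℚ)) (hp5 : 5 ≤ p)
    (hG : ¬ p ∣ Nat.card ((galoisRepTorsion W p).range.map Φ.toMonoidHom))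
    {C : Subgroup (GL (Fin 2) (ZMod p))} (hC : C ∈ cartanSubgroups (ZMod p))
    (hGN : (galoisRepTorsion W p).range.map Φ.toMonoidHom ≤
      Subgroup.normalizer (C : Set (GL (Fin 2) (ZMod p))))
    (hGC : ¬ (galoisRepTorsion W p).range.map Φ.toMonoidHom ≤ C) : False := by
  have hpp : p.Prime := hp.out
  have hp2 : p ≠ 2 := by omega
  have hp3 : 3 ≤ p := by omega
  set ρ := galoisRepTorsion W p with hρ
  have hGr : ¬ p ∣ Nat.card ρ.range := by rwa [← card_map_range_galoisRepTorsion W p Φ]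
  have hCp : (∃ P : GL (Fin 2) (ZMod p), C = splitCartan P) → p ≠ 2 := fun _ ↦ hp2
  refine false_of_index_two_of_forall_inertia_le (U := (C.comap Φ.toMonoidHom).comap ρ)
    (isOpen_comap_cartan W p Φ) (index_comap_cartan_eq_two W p Φ hC hCp hGN hGC) ?_
  intro v 𝔓 h𝔓 τ hτ
  rw [mem_comap_cartan_iff]
  by_cases hpv : (p : 𝓞 ℚ) ∈ v.asIdeal
  · -- at `p`: Prop. 14
    have hv : (primesEquiv v : ℕ) = p := primesEquiv_eq_of_natCast_mem hpp hpv
    have hHle : ((𝔓.inertia (absoluteGaloisGroup ℚ)).map ρ).map Φ.toMonoidHom ≤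
        ρ.range.map Φ.toMonoidHom := Subgroup.map_mono (fun x ⟨τ, _, hτ⟩ ↦ ⟨τ, hτ⟩)
    have hHN : ((𝔓.inertia (absoluteGaloisGroup ℚ)).map ρ).map Φ.toMonoidHom ≤
        Subgroup.normalizer (C : Set (GL (Fin 2) (ZMod p))) := hHle.trans hGN
    have hHC : ((𝔓.inertia (absoluteGaloisGroup ℚ)).map ρ).map Φ.toMonoidHom ≤ C := by
      rcases inertia_map_shape_of_isSemistable W p Φ e he hsemi hp2 hG hv h𝔓 with
        ⟨P, hP⟩ | ⟨k, hk, h2, hkH⟩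
      · rw [hP] at hHN ⊢
        exact prop14_halfSplitCartan hC hp5 hHN
      · rw [hkH] at hHN ⊢
        exact (prop14_unitGroup hC hp3 hk h2 hHN).le
    exact hHC ⟨ρ τ, ⟨τ, hτ, rfl⟩, rfl⟩
  · -- away from `p`: (ii)
    rw [galoisRepTorsion_eq_one_of_mem_inertia_of_isSemistable W p hsemi hGr hpv h𝔓 hτ, map_one]
    exact C.one_mem

end Frame

/-! ### Prop. 21 i) for `p ≠ 5` -/

/-- **Serre 1972, §5.4, Prop. 21 i) / Edixhoven 1997, Prop. 2.1 (after Oesterlé for `p = 2, 3`),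
for `p ≠ 5`: for a semistable `E/ℚ` in global minimal form, if `E[p]` is irreducible then
`ρ̄_{E,p} : Γ_ℚ → Aut(E[p])` is onto.**  Proof (module docstring): `p ∣ #G` ⇒ `G ⊇ SL₂`, onto;
`p ∤ #G`: `p = 2` — `#G ∣ 3`, and `#G = 3` gives an abelian cubic extension of `ℚ` unramified
outside `2` (`card_range_dvd_of_forall_inertia`: `3 ∤ 2ᵉ`), while `#G = 1` is Borel; `p = 3` —
`#G ∣ 16`; `#G ≤ 2` is abelian with complex conjugation, hence Borel
(`exists_le_eigenvectorStabilizer_of_comm`), and `#G ≥ 4` has an abelian quotient of order `4`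
(`exists_normal_index_eq_sq_of_card_eq_prime_pow`), an abelian quartic extension of `ℚ`
unramified outside `3` (`4 ∤ 2·3ᵉ`); `p ≥ 7` (and `p = 5` with non-split Cartan inertia) —
Prop. 17 with (iv) (`borel_or_normalizer_of_halfSplitCartan_le`,
`borel_or_normalizer_of_unitGroup_le`) and `false_of_le_normalizer_cartan_of_isSemistable`.
[cite: Serre1972, §5.4 Prop. 21 i)] [cite: Edixhoven1997, Prop. 2.1 and proof (PDF pp. 285–286)] -/
theorem hasSurjectiveModNGaloisRep_of_hasIrreducibleModPGaloisRep_of_ne_five [W.IsGloballyMinimal]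
    (hsemi : W.IsSemistable (𝓞 ℚ)) (hp5 : p ≠ 5) (hirr : W.HasIrreducibleModPGaloisRep p) :
    W.HasSurjectiveModNGaloisRep p := by
  letI : Module (ZMod p) (geomTorsion W p) := AddSubgroup.torsionBy.zmodModule
  have hpp : p.Prime := hp.out
  haveI : NeZero p := ⟨hpp.ne_zero⟩
  by_contra hns
  obtain ⟨e, Φ, he, -, -, -, c₀, hc₀, hc₀det⟩ := exists_frame_galoisRepTorsion_rat W p
  set ρ := galoisRepTorsion W p with hρ
  set G : Subgroup (GL (Fin 2) (ZMod p)) := ρ.range.map Φ.toMonoidHom with hG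
  have hGtop : G ≠ ⊤ := fun h ↦ hns ((map_range_galoisRepTorsion_eq_top_iff W p Φ).mp h)
  have hpG : ¬ p ∣ Nat.card G :=
    not_dvd_card_of_not_hasSurjectiveModNGaloisRep W p Φ e he hirr hns
  have hpGr : ¬ p ∣ Nat.card ρ.range := by rwa [← card_map_range_galoisRepTorsion W p Φ]
  have hcG : Φ (ρ c₀) ∈ G := apply_galoisRepTorsion_mem_map_range W p Φ c₀
  -- the surjection `θ : Γ_ℚ → G`, its kernel, and its triviality on inertia away from `p`
  set θ : absoluteGaloisGroup ℚ →* G := (Φ.toMonoidHom.comp ρ).codRestrict G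
    (fun σ ↦ apply_galoisRepTorsion_mem_map_range W p Φ σ) with hθ
  have hθval : ∀ σ, (θ σ : GL (Fin 2) (ZMod p)) = Φ (ρ σ) := fun σ ↦ rfl
  have hθsurj : Function.Surjective θ := by
    rintro ⟨g, hg⟩
    obtain ⟨σ, hσ⟩ := (mem_map_range_galoisRepTorsion_iff W p Φ).mp hg
    exact ⟨σ, Subtype.ext hσ⟩
  have hθker : θ.ker = ρ.ker := by
    ext σ
    rw [MonoidHom.mem_ker, MonoidHom.mem_ker, ← Subtype.coe_inj, hθval, OneMemClass.coe_one,
      map_eq_one_iff Φ Φ.injective]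
  have hkerOpen : IsOpen ((ρ.ker : Subgroup (absoluteGaloisGroup ℚ)) :
      Set (absoluteGaloisGroup ℚ)) :=
    isOpen_ker_galoisRepTorsion_holds W (n := p) (by exact_mod_cast hpp.ne_zero)
  have hθI : ∀ v : HeightOneSpectrum (𝓞 ℚ), (p : 𝓞 ℚ) ∉ v.asIdeal → ∀ 𝔓 ∈ v.primesAbove,
      ∀ τ ∈ 𝔓.inertia (absoluteGaloisGroup ℚ), θ τ = 1 := fun v hv 𝔓 h𝔓 τ hτ ↦ by
    rw [← MonoidHom.mem_ker, hθker, MonoidHom.mem_ker]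
    exact galoisRepTorsion_eq_one_of_mem_inertia_of_isSemistable W p hsemi hpGr hv h𝔓 hτ
  -- `#G ∣ #GL₂(𝔽_p) = (p² - 1)(p² - p)`
  have hGdvd : Nat.card G ∣ (p ^ 2 - 1) * (p ^ 2 - p) := by
    have h := Subgroup.card_subgroup_dvd_card G
    rwa [Matrix.card_GL_field, Fin.prod_univ_two, ZMod.card, Fin.val_zero, Fin.val_one, pow_zero,
      pow_one] at h
  -- a Borel `G` contradicts irreducibility
  have hBorel : ∀ {w : Fin 2 → ZMod p} (hw : w ≠ 0), ¬ G ≤ eigenvectorStabilizer w hw :=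
    fun hw ↦ not_le_eigenvectorStabilizer_of_hasIrreducibleModPGaloisRep W p Φ e he hirr hw
  have hw₀ : (Pi.single 0 1 : Fin 2 → ZMod p) ≠ 0 := fun h ↦ by
    have h0 : (Pi.single (0 : Fin 2) (1 : ZMod p) : Fin 2 → ZMod p) 0 = 0 := by
      rw [h]; rfl
    rw [Pi.single_eq_same] at h0
    exact one_ne_zero h0
  rcases Nat.lt_or_ge p 5 with hlt | hge
  · -- `p ∈ {2, 3}` (Edixhoven, after Oesterlé)
    have hp23 : p = 2 ∨ p = 3 := by
      have h2 := hpp.two_le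
      interval_cases p
      · exact Or.inl rfl
      · exact Or.inr rfl
      · exact absurd hpp (by decide)
    rcases hp23 with rfl | rfl
    · -- `p = 2`: `#G ∣ 3`
      have h3 : Nat.card G ∣ 3 := by
        have h' : Nat.card G ∣ 3 * 2 := by simpa using hGdvd
        exact (((Nat.Prime.coprime_iff_not_dvd Nat.prime_two).mpr hpG).symm).dvd_of_dvd_mul_right
          h'
      rcases (Nat.dvd_prime Nat.prime_three).mp h3 with h1 | h3
      · -- `G = 1` is Borel
        have hbot : G = ⊥ := Subgroup.eq_bot_of_card_eq G h1
        exact hBorel hw₀ (by rw [hbot]; exact bot_le)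
      · -- `#G = 3`: an abelian cubic extension of `ℚ` unramified outside `2`
        haveI : Fact (Nat.Prime 3) := ⟨Nat.prime_three⟩
        haveI : IsCyclic G := isCyclic_of_prime_card h3
        letI : CommGroup G := IsCyclic.commGroup
        obtain ⟨k, hk⟩ := card_range_dvd_of_forall_inertia Nat.prime_two θ
          (by rw [hθker]; exact hkerOpen) hθI
        have hrange : Nat.card θ.range = 3 := by
          rw [MonoidHom.range_eq_top.mpr hθsurj, Subgroup.card_top, h3]
        rw [hrange] at hk
        norm_num at hk
        have h32 : (3 : ℕ) ∣ 2 := Nat.prime_three.dvd_of_dvd_pow hk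
        omega
    · -- `p = 3`: `#G ∣ 16`
      have h16 : Nat.card G ∣ 2 ^ 4 := by
        have h' : Nat.card G ∣ 16 * 3 := by simpa using hGdvd
        exact (((Nat.Prime.coprime_iff_not_dvd Nat.prime_three).mpr hpG).symm).dvd_of_dvd_mul_right
          h'
      haveI h2f : Fact (Nat.Prime 2) := ⟨Nat.prime_two⟩
      obtain ⟨n, -, hn⟩ := (Nat.dvd_prime_pow Nat.prime_two).mp h16
      by_cases hn2 : 2 ≤ n
      · -- an abelian quotient of order `4`: a quartic abelian extension unramified outside `3`
        obtain ⟨N, hNn, hNi, hNc⟩ :=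
          exists_normal_index_eq_sq_of_card_eq_prime_pow (p := 2) n G hn hn2
        haveI := hNn
        letI : CommGroup (G ⧸ N) :=
          { (inferInstance : Group (G ⧸ N)) with
            mul_comm := fun x y ↦ by
              induction x using QuotientGroup.induction_on with | H a => ?_
              induction y using QuotientGroup.induction_on with | H b => ?_
              rw [← QuotientGroup.mk_mul, ← QuotientGroup.mk_mul, QuotientGroup.eq]
              have h := hNc b⁻¹ a⁻¹
              simpa only [_root_.mul_inv_rev, inv_inv, mul_assoc] using h }
        set ψ : absoluteGaloisGroup ℚ →* G ⧸ N := (QuotientGroup.mk' N).comp θ with hψ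
        have hψker : IsOpen ((ψ.ker : Subgroup (absoluteGaloisGroup ℚ)) :
            Set (absoluteGaloisGroup ℚ)) := by
          refine Subgroup.isOpen_mono (H₁ := ρ.ker) (fun σ hσ ↦ ?_) hkerOpen
          rw [MonoidHom.mem_ker, hψ, MonoidHom.comp_apply]
          have h1 : θ σ = 1 := by rw [← MonoidHom.mem_ker, hθker]; exact hσ
          rw [h1, map_one]
        obtain ⟨k, hk⟩ := card_range_dvd_of_forall_inertia Nat.prime_three ψ hψker
          (fun v hv 𝔓 h𝔓 τ hτ ↦ by rw [hψ, MonoidHom.comp_apply, hθI v hv 𝔓 h𝔓 τ hτ, map_one])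
        have hψsurj : Function.Surjective ψ := (QuotientGroup.mk'_surjective N).comp hθsurj
        have hrange : Nat.card ψ.range = 4 := by
          rw [MonoidHom.range_eq_top.mpr hψsurj, Subgroup.card_top]
          exact hNi.trans (by norm_num)
        rw [hrange] at hk
        norm_num at hk
        obtain ⟨m, hm⟩ := hk
        have h2 : (2 : ℕ) ∣ 3 ^ k := ⟨m, by omega⟩
        have h23 : (2 : ℕ) ∣ 3 := Nat.prime_two.dvd_of_dvd_pow h2
        omega
      · -- `#G ≤ 2`: `G` is abelian and contains complex conjugation, hence Borel
        push Not at hn2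
        interval_cases n
        · have hbot : G = ⊥ := Subgroup.eq_bot_of_card_eq G (by rw [hn, pow_zero])
          exact hBorel hw₀ (by rw [hbot]; exact bot_le)
        · haveI : IsCyclic G := isCyclic_of_prime_card (p := 2) (by rw [hn, pow_one])
          letI : CommGroup G := IsCyclic.commGroup
          have hcomm : ∀ a ∈ G, ∀ b ∈ G, a * b = b * a := fun a ha b hb ↦
            congrArg Subtype.val (mul_comm (⟨a, ha⟩ : G) ⟨b, hb⟩)
          obtain ⟨w, hw, hB⟩ := exists_le_eigenvectorStabilizer_of_comm (F := ZMod 3)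
            (DeligneSerre1974.two_ne_zero_of_ne_two (ℓ := 3) (by norm_num)) hcomm hcG hc₀ hc₀det
          exact hBorel hw hB
  · -- `p ≥ 5` (`p ≠ 5` only matters for a split half-Cartan inertia): Prop. 17 and case 3)
    have hp2 : p ≠ 2 := by omega
    obtain ⟨v, hv⟩ : ∃ v : HeightOneSpectrum (𝓞 ℚ), (primesEquiv v : ℕ) = p :=
      ⟨primesEquiv.symm ⟨p, hpp⟩, by rw [Equiv.apply_symm_apply]⟩
    obtain ⟨𝔏₀, h𝔏₀⟩ := v.primesAbove_nonempty
    have hHle : ((𝔏₀.inertia (absoluteGaloisGroup ℚ)).map ρ).map Φ.toMonoidHom ≤ G :=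
      Subgroup.map_mono (fun x ⟨τ, _, hτ⟩ ↦ ⟨τ, hτ⟩)
    have hres : (∃ (w : Fin 2 → ZMod p) (hw : w ≠ 0), G ≤ eigenvectorStabilizer w hw) ∨
        ∃ C ∈ cartanSubgroups (ZMod p),
          G ≤ Subgroup.normalizer (C : Set (GL (Fin 2) (ZMod p))) ∧ ¬ G ≤ C := by
      rcases inertia_map_shape_of_isSemistable W p Φ e he hsemi hp2 hpG hv h𝔏₀ with
        ⟨P, hP⟩ | ⟨k, hk, h2, hkH⟩
      · exact borel_or_normalizer_of_halfSplitCartan_le G hp2 hp5 (hP ▸ hHle) hGtop hcG hc₀ hc₀det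
      · exact borel_or_normalizer_of_unitGroup_le G hp2 hk h2 (hkH ▸ hHle) hGtop hcG hc₀ hc₀det
    rcases hres with ⟨w, hw, hB⟩ | ⟨C, hC, hGN, hGC⟩
    · exact hBorel hw hB
    · exact false_of_le_normalizer_cartan_of_isSemistable W p Φ e he hsemi hge hpG hC hGN hGC

end WeierstrassCurve

end
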